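import Mathlib.Analysis.SpecialFunctions.Stirling
import HarnessLib

/-!
# Robbins' two-sided Stirling bound for `log n!`

`n log n - n + ½ log(2πn) ≤ log n! ≤ n log n - n + ½ log(2πn) + 1/(12n)` for `n ≥ 1`: the lower
bound is Mathlib's `Stirling.le_log_factorial_stirling`; the upper bound follows from Robbins'
stepwise bound `log s_n - log s_{n+1} ≤ 1/(12n(n+1))` (Mathlib `Stirling.log_stirlingSeq_sdiff_le`):
the sequence `log s_n - 1/(12n)` increases to `log √π`.

All statements are folklore (H. Robbins, *A remark on Stirling's formula*, Amer. Math. Monthly 62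
(1955) 26–29); theorems only.
-/

noncomputable section

open Real Filter Topology

namespace Literature.Analysis.SpecialFunctions

/-- **Robbins' monotonicity**: `n ↦ log (stirlingSeq (n+1)) - 1/(12(n+1))` is increasing.
[folklore] -/
theorem monotone_log_stirlingSeq_sub :
    Monotone fun n : ℕ => Real.log (Stirling.stirlingSeq (n + 1)) - 1 / (12 * ((n : ℝ) + 1)) := by
  refine monotone_nat_of_le_succ (fun n => ?_)
  have h := Stirling.log_stirlingSeq_sdiff_le (n + 1)
  have e : (1 : ℝ) / (12 * ((n + 1 : ℕ) : ℝ) * (((n + 1 : ℕ) : ℝ) + 1)) =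
      1 / (12 * ((n : ℝ) + 1)) - 1 / (12 * (((n + 1 : ℕ) : ℝ) + 1)) := by
    push_cast
    field_simp
    ring
  rw [e] at h
  linarith

/-- `log (stirlingSeq (n+1)) - 1/(12(n+1)) → log √π`. [folklore] -/
theorem tendsto_log_stirlingSeq_sub :
    Tendsto (fun n : ℕ => Real.log (Stirling.stirlingSeq (n + 1)) - 1 / (12 * ((n : ℝ) + 1)))
      atTop (𝓝 (Real.log (Real.sqrt π))) := by
  have h1 : Tendsto (fun n : ℕ => Real.log (Stirling.stirlingSeq (n + 1))) atTop
      (𝓝 (Real.log (Real.sqrt π))) := by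
    have hπ : Real.sqrt π ≠ 0 := (Real.sqrt_pos.mpr Real.pi_pos).ne'
    exact ((Real.continuousAt_log hπ).tendsto).comp
      (Stirling.tendsto_stirlingSeq_sqrt_pi.comp (tendsto_add_atTop_nat 1))
  have h2 : Tendsto (fun n : ℕ => 1 / (12 * ((n : ℝ) + 1))) atTop (𝓝 0) := by
    have h3 : Tendsto (fun n : ℕ => 12 * ((n : ℝ) + 1)) atTop atTop := by
      refine Tendsto.const_mul_atTop (by norm_num) ?_
      exact tendsto_atTop_add_const_right _ 1 tendsto_natCast_atTop_atTop
    have h4 := h3.inv_tendsto_atTop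
    refine h4.congr (fun n => ?_)
    simp only [Pi.inv_apply, one_div]
  simpa using h1.sub h2

/-- **Robbins' upper bound for the Stirling sequence**: `log (stirlingSeq n) ≤ log √π + 1/(12n)`
for `n ≥ 1`. [folklore] -/
theorem log_stirlingSeq_le {n : ℕ} (hn : n ≠ 0) :
    Real.log (Stirling.stirlingSeq n) ≤ Real.log (Real.sqrt π) + 1 / (12 * (n : ℝ)) := by
  obtain ⟨k, rfl⟩ : ∃ k, n = k + 1 := ⟨n - 1, by omega⟩
  have h := monotone_log_stirlingSeq_sub.ge_of_tendsto tendsto_log_stirlingSeq_sub k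
  push_cast
  linarith

/-- **Robbins' two-sided Stirling bound, upper half**:
`log n! ≤ n log n - n + (log n)/2 + (log 2π)/2 + 1/(12n)` for `n ≥ 1`. [folklore] -/
theorem log_factorial_le_stirling {n : ℕ} (hn : n ≠ 0) :
    Real.log (n.factorial : ℝ) ≤
      n * Real.log n - n + Real.log n / 2 + Real.log (2 * π) / 2 + 1 / (12 * (n : ℝ)) := by
  have h := log_stirlingSeq_le hn
  rw [Stirling.log_stirlingSeq_formula] at h
  have hn' : (0 : ℝ) < n := by exact_mod_cast Nat.pos_of_ne_zero hn
  rw [Real.log_div hn'.ne' (Real.exp_pos 1).ne', Real.log_exp, Real.log_mul two_ne_zero hn'.ne',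
    Real.log_sqrt Real.pi_pos.le] at h
  rw [Real.log_mul two_ne_zero Real.pi_pos.ne']
  linarith

/-- **Robbins' two-sided Stirling bound**: `|log n! - (n log n - n + ½ log(2πn))| ≤ 1/(12n)` for
`n ≥ 1` (indeed the difference lies in `[0, 1/(12n)]`). [folklore] -/
theorem abs_log_factorial_sub_stirling_le {n : ℕ} (hn : n ≠ 0) :
    0 ≤ Real.log (n.factorial : ℝ) - (n * Real.log n - n + Real.log (2 * π * n) / 2) ∧
      Real.log (n.factorial : ℝ) - (n * Real.log n - n + Real.log (2 * π * n) / 2) ≤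
        1 / (12 * (n : ℝ)) := by
  have hn' : (0 : ℝ) < n := by exact_mod_cast Nat.pos_of_ne_zero hn
  have hlo := Stirling.le_log_factorial_stirling hn
  have hhi := log_factorial_le_stirling hn
  rw [Real.log_mul (by positivity) hn'.ne']
  constructor <;> linarith

end Literature.Analysis.SpecialFunctions
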